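import Summits.AtomisticToContinuum.HydrodynamicLimit.Theorems.InformationPercolationEngineChaosClosesEulerReadoutWindow
import Summits.AtomisticToContinuum.HydrodynamicLimit.Theorems.InformationPercolationEngineChaosClosesEulerReadoutMeasurable
import Summits.AtomisticToContinuum.HydrodynamicLimit.Theorems.InformationPercolationEngineKineticClosureBridge
import Literature.MathematicalPhysics.KineticTheory.HardSphereBBGKYLiouvilleFlow
import HarnessLib

/-!
# Weak readout at the instant `t` (crux `ChaosClosesEuler`, stmt-AtomisticToContinuum-15141, line `Sketch`,
# stub `stub_readout`) — helper 5a: the good events along one orbit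

WHAT. Deterministic consequences, along ONE good orbit `s ↦ Φ_s z`, of lying outside the bad events:

* `kfac_windowQuad_le` — on the complement of the collision-tail, collision-rate and density-cap events, the
  normalised windowed quadratic collision functional `(ε/(N+1)) · K^{(t,t+Δ]}[1 + |vᵢ|² + |vⱼ|²]` is at most
  `(1 + L⁺)(η₃ + σ³ · 3Δ · C_gY · C_B) + η₂` (domination by the cut-off count plus the tail, the cut-off count read
  off the `CollisionRate` deviation, the Enskog functional bounded under the cap — all `r`-independent);
* `integrableOn_err`, `exists_good_instant` — the pathwise `L¹(dx)` errors of the three cone-mollified fields against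
  jointly continuous fields are integrable in time on compact windows (Fubini measurability from the measurability of
  the orbit, boundedness from the cone peak and the conserved energy), so the time-averaged smallness over `[t, t+Δ]`
  yields one instant `s₀` of the window where their sum is `≤ 2η₁`;
* `stub_readoutEvents` (the registered sub-goal) — `Y = (3/2π) f_ex'` is bounded on `[0, η₀ᵉ/2]` (the PROVED low-density
  equation of state `HsEosLowDensity`: `f_ex` is analytic near `[0, η₀ᵉ)`); `euler_continuousOn` — joint
  continuity of the classical Euler fields.

No named fact is invoked.
-/

noncomputable section

namespace Summit.AtomisticToContinuum.HydrodynamicLimit.Theorems.ChaosClosesEulerReadout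

open scoped BigOperators Topology Classical MeasureTheory ENNReal InnerProductSpace
open Filter Set MeasureTheory Function
open Literature.MathematicalPhysics.KineticTheory
open Literature.Analysis.FluidPDE
open Literature.Analysis.FunctionSpaces
open Summit.AtomisticToContinuum.HydrodynamicLimit.Theorems.DensityCapNegative
  (cone cone_nonneg cone_le mollDensity_eq mollDensity_nonneg mollDensity_le)
open Summit.AtomisticToContinuum.HydrodynamicLimit.Theorems.KineticClosureDensity
  (continuous_cone_right continuous_mollDensity abs_empiricalDensityField_sub_integral_mul_mollDensity_le)
open Summit.AtomisticToContinuum.HydrodynamicLimit.Theorems.KineticClosureBridge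
  (meanSpeed_le meanEnergy_eq norm_empiricalMomentumField_sub_integral_smul_le
    abs_empiricalEnergyField_sub_integral_mul_le continuous_mollMomentum continuous_mollEnergy
    norm_integral_smul_sub_le abs_integral_mul_sub_le)

/-! ## §1 The equation of state and the Euler fields -/

/-- **Registered sub-goal `stub_readoutEvents` (helper 5a of `stub_readout`): `Y = (3/2π) f_ex'` is bounded in
the band.** From the PROVED low-density equation of state (`f_ex` agrees on `[0, η₀ᵉ)` with a function analytic on
`(−η₀ᵉ, η₀ᵉ)`): `|f_ex'| ≤ C` on `[0, η₀ᵉ/2]` (inside, `f_ex' = F'` is continuous; at `0` it is one number).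
[folklore] -/
theorem stub_readoutEvents : ∀ {η₀E : ℝ}, 0 < η₀E → ∀ {F : ℝ → ℝ}, AnalyticOnNhd ℝ F (Set.Ioo (-η₀E) η₀E) → Set.EqOn hsExcessFreeEnergy F (Set.Ico 0 η₀E) → ∃ C : ℝ, 0 ≤ C ∧ ∀ a ∈ Set.Icc 0 (η₀E / 2), |deriv hsExcessFreeEnergy a| ≤ C := by
  intro η₀E hη₀E F hFan hFeq
  have hcont : ContinuousOn (deriv F) (Set.Ioo (-η₀E) η₀E) := hFan.deriv.continuousOn
  obtain ⟨C, hC⟩ := (isCompact_Icc : IsCompact (Set.Icc 0 (η₀E / 2))).exists_bound_of_continuousOn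
    (hcont.mono (Set.Icc_subset_Ioo (by linarith) (by linarith)))
  refine ⟨max C |deriv hsExcessFreeEnergy 0|, le_max_of_le_right (abs_nonneg _), fun a ha => ?_⟩
  rcases ha.1.eq_or_lt with h0 | ha0
  · rw [← h0]
    exact le_max_right _ _
  · have heq : deriv hsExcessFreeEnergy a = deriv F a := by
      refine Filter.EventuallyEq.deriv_eq ?_
      have hmem : Set.Ioo 0 η₀E ∈ 𝓝 a := Ioo_mem_nhds ha0 (by linarith [ha.2])
      filter_upwards [hmem] with x hx using hFeq ⟨hx.1.le, hx.2⟩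
    rw [heq, ← Real.norm_eq_abs]
    exact (hC a ha).trans (le_max_left _ _)

/-- **Joint continuity of the classical Euler fields** on `[a, a'] × 𝕋³` for `0 ≤ a`, `a' < T`: the density,
the momentum density `ρu` and the total energy density `E(ρ, u, θ)`. [folklore] -/
theorem euler_continuousOn {σ T : ℝ} {ρ θ : ℝ → T3 → ℝ} {u : ℝ → T3 → V3} (hE : IsHardSphereEulerSolution σ T ρ u θ)
    {a a' : ℝ} (ha : 0 ≤ a) (ha' : a' < T) :
    ContinuousOn (uncurry ρ) (Set.Icc a a' ×ˢ univ) ∧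
    ContinuousOn (uncurry fun s x => ρ s x • u s x) (Set.Icc a a' ×ˢ univ) ∧
    ContinuousOn (uncurry fun s x => totalEnergyDensity (ρ s x) (u s x) (θ s x)) (Set.Icc a a' ×ˢ univ) := by
  have hsub : Set.Icc a a' ×ˢ (univ : Set T3) ⊆ Set.Ico 0 T ×ˢ univ :=
    prod_mono (fun s hs => ⟨ha.trans hs.1, hs.2.trans_lt ha'⟩) subset_rfl
  have hρ : ContinuousOn (uncurry ρ) (Set.Icc a a' ×ˢ univ) :=
    (Torus.continuousOn_uncurry_of_continuousOn_stLift hE.smooth_density.continuousOn_stLift).mono hsub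
  have hu : ContinuousOn (uncurry u) (Set.Icc a a' ×ˢ univ) :=
    (Torus.continuousOn_uncurry_of_continuousOn_stLift hE.smooth_velocity.continuousOn_stLift).mono hsub
  have hθ : ContinuousOn (uncurry θ) (Set.Icc a a' ×ˢ univ) :=
    (Torus.continuousOn_uncurry_of_continuousOn_stLift hE.smooth_temperature.continuousOn_stLift).mono hsub
  refine ⟨hρ, hρ.smul hu, ?_⟩
  have h : (uncurry fun s x => totalEnergyDensity (ρ s x) (u s x) (θ s x)) =
      fun p => uncurry ρ p * (‖uncurry u p‖ ^ 2 / 2 + 3 / 2 * uncurry θ p) := by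
    funext p
    rfl
  rw [h]
  exact hρ.mul (((hu.norm.pow 2).div_const 2).add (continuousOn_const.mul hθ))

/-! ## §2 The windowed quadratic functional on the good events -/

/-- **The normalised windowed quadratic collision functional on the good events.** Along a good orbit, if
(i) the density cap holds at scale `r` on `[0, τ₁]` (`ρ_r ≤ ρ + η_cap`) and the guard `ρσ³ < η₀ ≤ η_g/2`,
`σ³η_cap ≤ η_g/2` hold (so every collision of the window is in band and `σ³ρ_r ≤ η₀ + σ³η_cap`), (ii) the quadratic
collision tail beyond level `Lv` over `[0, τ₁]` is `≤ η₂`, (iii) the `CollisionRate` deviation for the test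
`bump_Δ(s) · g(σ³ρ_r)` is `≤ η₃`, (iv) `|f_ex'| ≤ C_Y` below `η_{g2}` and the energy per particle is `≤ K_E`, then
`(ε/(N+1)) · K^{(t,t+Δ]}[1 + |vᵢ|² + |vⱼ|²] ≤ (1 + Lv⁺)(η₃ + σ³ · 3Δ · (3C_Y/2π) · 2π(η₀/σ³ + η_cap)(1/2 + K_E)) + η₂`.
[folklore] -/
theorem kfac_windowQuad_le {N : ℕ} {σ : ℝ} (hσ : 0 < σ) (hσ1 : σ ^ 3 ≤ 1)
    (Φ : HardSphereFlow (Torus.geometry (Fin 3)) (hsDiameter σ N) (N + 1))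
    {z : Config (N + 1) (Fin 3) T3} (hz : z ∈ Φ.good)
    {T : ℝ} {ρ : ℝ → T3 → ℝ} {t Δ τ₁ : ℝ} (ht0 : 0 ≤ t) (hΔ : 0 < Δ) (hτ : t + Δ ≤ τ₁) (hτT : τ₁ < T)
    {η₀ ηg ηg2 ηcap : ℝ} (hη₀ : 0 ≤ η₀) (hg12 : ηg < ηg2) (hη₀g : η₀ ≤ ηg / 2) (hcapg : ηcap ≤ ηg / 2)
    (hcap0 : 0 ≤ ηcap) (hguard : ∀ s ∈ Set.Ico 0 T, ∀ x, ρ s x * σ ^ 3 < η₀)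
    {KE : ℝ} (hKE0 : 0 ≤ KE) (hEz : ((N + 1 : ℕ) : ℝ)⁻¹ * configEnergy z ≤ KE)
    {r : ℝ} (hr : 0 < r) (hr2 : r ≤ 1 / 2) {Lv η₂ : ℝ}
    (htail : hsDiameter σ N / ((N : ℝ) + 1) *
      (∑ᶠ (s : ℝ) (_ : s ∈ collisionTimes (Torus.geometry (Fin 3)) (hsDiameter σ N) (fun s => Φ.flow s z) ∩
        Set.Icc 0 τ₁), ∑ i : Fin (N + 1), ∑ j : Fin (N + 1),
        (if i ≠ j ∧ ‖(Torus.geometry (Fin 3)).sepVec (Φ.flow s z i).1 (Φ.flow s z j).1‖ = hsDiameter σ N then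
          (if Lv < ‖(Φ.flow s z i).2‖ ^ 2 + ‖(Φ.flow s z j).2‖ ^ 2 then
            1 + ‖(Φ.flow s z i).2‖ ^ 2 + ‖(Φ.flow s z j).2‖ ^ 2 else 0) else 0)) ≤ η₂)
    {CY η₃ : ℝ} (hCY0 : 0 ≤ CY) (hCY : ∀ a ∈ Set.Icc 0 ηg2, |deriv hsExcessFreeEnergy a| ≤ CY)
    (hcr : |hsDiameter σ N / ((N : ℝ) + 1) *
      (∑ᶠ (s : ℝ) (_ : s ∈ collisionTimes (Torus.geometry (Fin 3)) (hsDiameter σ N) (fun s => Φ.flow s z) ∩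
        Set.Icc 0 τ₁), ∑ i : Fin (N + 1), ∑ j : Fin (N + 1),
        (if i ≠ j ∧ ‖(Torus.geometry (Fin 3)).sepVec (Φ.flow s z i).1 (Φ.flow s z j).1‖ = hsDiameter σ N then
          max 0 (min 1 (min ((s - t + Δ) / Δ) ((t + 2 * Δ - s) / Δ))) *
            max 0 (min 1 ((ηg2 - σ ^ 3 * DensityCapNegative.mollDensity r (Φ.flow s z) (Φ.flow s z i).1) / (ηg2 - ηg)))
          else 0)) -
      σ ^ 3 * ∫ s in Set.Icc (0 : ℝ) τ₁, ∫ x : T3,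
        max 0 (min 1 (min ((s - t + Δ) / Δ) ((t + 2 * Δ - s) / Δ))) *
          max 0 (min 1 ((ηg2 - σ ^ 3 * DensityCapNegative.mollDensity r (Φ.flow s z) x) / (ηg2 - ηg))) *
          (3 / (2 * Real.pi) * deriv hsExcessFreeEnergy (σ ^ 3 * DensityCapNegative.mollDensity r (Φ.flow s z) x)) *
          ∫ p, cone r p.1.1 x * cone r p.2.1 x * (Real.pi * ‖p.1.2 - p.2.2‖)
            ∂((empiricalMeasure (Φ.flow s z)).prod (empiricalMeasure (Φ.flow s z)))| ≤ η₃)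
    (hcapev : ∀ s ∈ Set.Icc 0 τ₁, ∀ x, DensityCapNegative.mollDensity r (Φ.flow s z) x ≤ ρ s x + ηcap) :
    hsDiameter σ N / ((N : ℝ) + 1) * collisionPairSum (Torus.geometry (Fin 3)) (hsDiameter σ N) (fun s => Φ.flow s z)
      (Set.Ioc t (t + Δ)) (fun s i j => 1 + ‖(Φ.flow s z i).2‖ ^ 2 + ‖(Φ.flow s z j).2‖ ^ 2) ≤
      (1 + max Lv 0) * (η₃ + σ ^ 3 * (3 * Δ * (3 / (2 * Real.pi) * CY) *
        (2 * Real.pi * (η₀ / σ ^ 3 + ηcap) * (1 / 2 + KE)))) + η₂ := by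
  have hγ : IsHardSphereTrajectory (Torus.geometry (Fin 3)) (hsDiameter σ N) (N + 1) (fun s => Φ.flow s z) :=
    Φ.isTrajectory z hz
  have hσ3 : 0 < σ ^ 3 := by positivity
  have hK0 : 0 ≤ hsDiameter σ N / ((N : ℝ) + 1) := div_nonneg (hsDiameter_pos hσ N).le (by positivity)
  have hEs : ∀ s, configEnergy (Φ.flow s z) = configEnergy z := fun s => Φ.configEnergy_flow hz s
  -- consequences of the cap and the guard
  have hcapR : ∀ s ∈ Set.Icc 0 τ₁, ∀ x, DensityCapNegative.mollDensity r (Φ.flow s z) x ≤ η₀ / σ ^ 3 + ηcap := by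
    intro s hs x
    have hg := hguard s ⟨hs.1, hs.2.trans_lt hτT⟩ x
    have hρle : ρ s x ≤ η₀ / σ ^ 3 := by rw [le_div_iff₀ hσ3]; exact hg.le
    linarith [hcapev s hs x]
  have hR0 : 0 ≤ η₀ / σ ^ 3 + ηcap := add_nonneg (div_nonneg hη₀ hσ3.le) hcap0
  have hcapg' : ∀ s ∈ Set.Icc 0 τ₁, ∀ x, σ ^ 3 * DensityCapNegative.mollDensity r (Φ.flow s z) x ≤ ηg := by
    intro s hs x
    have h1 := hcapev s hs x
    have h2 := hguard s ⟨hs.1, hs.2.trans_lt hτT⟩ x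
    calc σ ^ 3 * DensityCapNegative.mollDensity r (Φ.flow s z) x ≤ σ ^ 3 * (ρ s x + ηcap) :=
          mul_le_mul_of_nonneg_left h1 hσ3.le
      _ = ρ s x * σ ^ 3 + σ ^ 3 * ηcap := by ring
      _ ≤ η₀ + 1 * ηcap := add_le_add h2.le (mul_le_mul_of_nonneg_right hσ1 hcap0)
      _ ≤ ηg := by linarith
  -- (a) domination by the cut-off count plus the tail
  have ha := window_quad_le_count_add_tail (hγ.locFinite 0 τ₁) ht0 hτ Lv
    (fun s i => max 0 (min 1 (min ((s - t + Δ) / Δ) ((t + 2 * Δ - s) / Δ))) *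
      max 0 (min 1 ((ηg2 - σ ^ 3 * DensityCapNegative.mollDensity r (Φ.flow s z) (Φ.flow s z i).1) / (ηg2 - ηg))))
    (fun s i => mul_nonneg (bump_mem t Δ s).1 (cut_mem ηg ηg2 _).1)
    (fun s hs i => by
      rw [bump_eq_one hΔ ⟨hs.1.le, hs.2⟩, one_mul]
      exact cut_eq_one hg12 (hcapg' s ⟨ht0.trans hs.1.le, hs.2.trans hτ⟩ _))
  rw [← collisionPairSum_eq_finsum_ite (fun s => hγ.mem s)] at ha
  -- (c) the cut-off count from the collision-rate deviation
  set A : ℝ := hsDiameter σ N / ((N : ℝ) + 1) *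
      (∑ᶠ (s : ℝ) (_ : s ∈ collisionTimes (Torus.geometry (Fin 3)) (hsDiameter σ N) (fun s => Φ.flow s z) ∩
        Set.Icc 0 τ₁), ∑ i : Fin (N + 1), ∑ j : Fin (N + 1),
        (if i ≠ j ∧ ‖(Torus.geometry (Fin 3)).sepVec (Φ.flow s z i).1 (Φ.flow s z j).1‖ = hsDiameter σ N then
          max 0 (min 1 (min ((s - t + Δ) / Δ) ((t + 2 * Δ - s) / Δ))) *
            max 0 (min 1 ((ηg2 - σ ^ 3 * DensityCapNegative.mollDensity r (Φ.flow s z) (Φ.flow s z i).1) / (ηg2 - ηg)))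
          else 0)) with hA
  set II : ℝ := ∫ s in Set.Icc (0 : ℝ) τ₁, ∫ x : T3,
        max 0 (min 1 (min ((s - t + Δ) / Δ) ((t + 2 * Δ - s) / Δ))) *
          max 0 (min 1 ((ηg2 - σ ^ 3 * DensityCapNegative.mollDensity r (Φ.flow s z) x) / (ηg2 - ηg))) *
          (3 / (2 * Real.pi) * deriv hsExcessFreeEnergy (σ ^ 3 * DensityCapNegative.mollDensity r (Φ.flow s z) x)) *
          ∫ p, cone r p.1.1 x * cone r p.2.1 x * (Real.pi * ‖p.1.2 - p.2.2‖)
            ∂((empiricalMeasure (Φ.flow s z)).prod (empiricalMeasure (Φ.flow s z))) with hII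
  have hc : A ≤ η₃ + σ ^ 3 * |II| := by
    have h1 := le_abs_self (A - σ ^ 3 * II)
    have h2 := le_abs_self (σ ^ 3 * II)
    rw [abs_mul, abs_of_pos hσ3] at h2
    linarith [hcr]
  -- (d) the Enskog functional under the cap
  have hgY : ∀ a, 0 ≤ a → |max 0 (min 1 ((ηg2 - a) / (ηg2 - ηg))) * (3 / (2 * Real.pi) * deriv hsExcessFreeEnergy a)| ≤
      3 / (2 * Real.pi) * CY := by
    intro a ha0
    by_cases ha2 : a < ηg2
    · rw [abs_mul, abs_mul, abs_of_pos (by positivity : (0 : ℝ) < 3 / (2 * Real.pi))]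
      calc |max 0 (min 1 ((ηg2 - a) / (ηg2 - ηg)))| * (3 / (2 * Real.pi) * |deriv hsExcessFreeEnergy a|) ≤
          1 * (3 / (2 * Real.pi) * CY) := by
            refine mul_le_mul ?_ ?_ (by positivity) zero_le_one
            · rw [abs_of_nonneg (cut_mem ηg ηg2 a).1]
              exact (cut_mem ηg ηg2 a).2
            · exact mul_le_mul_of_nonneg_left (hCY a ⟨ha0, ha2.le⟩) (by positivity)
        _ = 3 / (2 * Real.pi) * CY := one_mul _
    · rw [cut_eq_zero hg12 (not_lt.1 ha2), zero_mul, abs_zero]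
      positivity
  have hd := abs_setIntegral_integral_bump_le (τ := τ₁) (continuous_bump t Δ) (fun s => (bump_mem t Δ s).1)
    (fun s => (bump_mem t Δ s).2) hΔ.le (fun s hs => bump_eq_zero hΔ hs) (by positivity) hgY
    (g := fun a => max 0 (min 1 ((ηg2 - a) / (ηg2 - ηg)))) (Y := fun a => 3 / (2 * Real.pi) * deriv hsExcessFreeEnergy a)
    (a := fun s x => σ ^ 3 * DensityCapNegative.mollDensity r (Φ.flow s z) x)
    (fun s x => mul_nonneg hσ3.le (mollDensity_nonneg hr _ _))
    (B := fun s x => ∫ p, cone r p.1.1 x * cone r p.2.1 x * (Real.pi * ‖p.1.2 - p.2.2‖)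
      ∂((empiricalMeasure (Φ.flow s z)).prod (empiricalMeasure (Φ.flow s z))))
    (fun s x => B1_nonneg _ hr x) (fun s => continuous_B1 (Φ.flow s z) r)
    (CB := 2 * Real.pi * (η₀ / σ ^ 3 + ηcap) * (1 / 2 + KE)) (by positivity)
    (fun s hs => by
      calc _ ≤ 2 * Real.pi * (η₀ / σ ^ 3 + ηcap) * (((N + 1 : ℕ) : ℝ)⁻¹ * ∑ i, ‖(Φ.flow s z i).2‖) :=
            integral_B1_le (Φ.flow s z) hr hr2 (hcapR s hs)
        _ ≤ 2 * Real.pi * (η₀ / σ ^ 3 + ηcap) * (1 / 2 + KE) := by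
            refine mul_le_mul_of_nonneg_left ?_ (by positivity)
            have h := meanSpeed_le (Φ.flow s z)
            rw [hEs s] at h
            linarith)
  -- combine
  calc hsDiameter σ N / ((N : ℝ) + 1) * collisionPairSum (Torus.geometry (Fin 3)) (hsDiameter σ N) (fun s => Φ.flow s z)
        (Set.Ioc t (t + Δ)) (fun s i j => 1 + ‖(Φ.flow s z i).2‖ ^ 2 + ‖(Φ.flow s z j).2‖ ^ 2)
      ≤ hsDiameter σ N / ((N : ℝ) + 1) * ((1 + max Lv 0) * _ + _) := mul_le_mul_of_nonneg_left ha hK0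
    _ = (1 + max Lv 0) * A + hsDiameter σ N / ((N : ℝ) + 1) * _ := by rw [hA]; ring
    _ ≤ (1 + max Lv 0) * (η₃ + σ ^ 3 * |II|) + η₂ :=
        add_le_add (mul_le_mul_of_nonneg_left hc (by positivity)) htail
    _ ≤ (1 + max Lv 0) * (η₃ + σ ^ 3 * (3 * Δ * (3 / (2 * Real.pi) * CY) *
        (2 * Real.pi * (η₀ / σ ^ 3 + ηcap) * (1 / 2 + KE)))) + η₂ := by
        rw [hII]
        gcongr

/-! ## §3 Integrability of the pathwise window errors -/

/-- The cone kernel is jointly continuous. [folklore] -/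
theorem continuous_uncurry_cone (r : ℝ) : Continuous (uncurry (cone r)) := by
  unfold cone
  refine continuous_const.mul ((continuous_const.sub ?_).max continuous_const)
  exact Torus.continuous_euclidDist.div_const r

/-- Along a measurable curve of configurations the scalar cone-mollified fields `(s, x) ↦ Σᵢ b_r(xᵢ(s), x) c(vᵢ(s))`
are jointly measurable. [folklore] -/
theorem measurable_sum_cone_mul {n : ℕ} {γ : ℝ → Config n (Fin 3) T3} (hγ : Measurable γ) (r : ℝ)
    {c : V3 → ℝ} (hc : Continuous c) :
    Measurable fun p : ℝ × T3 => ∑ i, cone r (γ p.1 i).1 p.2 * c (γ p.1 i).2 := by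
  have h := measurable_sum_kernel_smul hγ (continuous_uncurry_cone r) hc
  simpa only [smul_eq_mul] using h

/-- **Integrability of the pathwise window errors.** Along a good orbit of a hard-sphere flow on `𝕋³`, for
`r > 0` and fields `gρ, gm, ge` jointly continuous on `[a, b] × 𝕋³`, the sum of the three `L¹(dx)` errors of the
`r`-cone-mollified empirical density / momentum / energy fields against `gρ, gm, ge` is integrable in time on
`[a, b]` (Fubini measurability from the measurability of the orbit; boundedness from the cone peak `3/(πr³)` and the
conserved energy). [folklore] -/
theorem integrableOn_err {N : ℕ} {ε : ℝ} (Φ : HardSphereFlow (Torus.geometry (Fin 3)) ε (N + 1))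
    {z : Config (N + 1) (Fin 3) T3} (hz : z ∈ Φ.good) {r : ℝ} (hr : 0 < r) {a b : ℝ}
    {gρ ge : ℝ → T3 → ℝ} {gm : ℝ → T3 → V3}
    (hgρ : ContinuousOn (uncurry gρ) (Set.Icc a b ×ˢ univ)) (hgm : ContinuousOn (uncurry gm) (Set.Icc a b ×ˢ univ))
    (hge : ContinuousOn (uncurry ge) (Set.Icc a b ×ˢ univ)) :
    IntegrableOn (fun s =>
      (∫ x, |empiricalDensityField (Φ.flow s z) (fun y => cone r y x) - gρ s x|) +
      (∫ x, ‖empiricalMomentumField (Φ.flow s z) (fun y => cone r y x) - gm s x‖) +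
      ∫ x, |empiricalEnergyField (Φ.flow s z) (fun y => cone r y x) - ge s x|) (Set.Icc a b) volume := by
  have hγ : Measurable fun s => Φ.flow s z := (Φ.isTrajectory z hz).measurable_torus
  have hn0 : 0 < ((N + 1 : ℕ) : ℝ) := by positivity
  have hpeak : 0 ≤ 3 / (Real.pi * r ^ 3) := by positivity
  have hE : ∀ s, configEnergy (Φ.flow s z) = configEnergy z := fun s => Φ.configEnergy_flow hz s
  obtain ⟨Cρ, hCρ0, hCρ⟩ := exists_bound_of_continuousOn_uncurry hgρ
  obtain ⟨Cm, hCm0, hCm⟩ := exists_bound_of_continuousOn_uncurry hgm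
  obtain ⟨Ce, hCe0, hCe⟩ := exists_bound_of_continuousOn_uncurry hge
  refine IntegrableOn.add (IntegrableOn.add ?_ ?_) ?_
  · -- density
    have hF : Measurable fun p : ℝ × T3 => empiricalDensityField (Φ.flow p.1 z) (fun y => cone r y p.2) := by
      have heq : (fun p : ℝ × T3 => empiricalDensityField (Φ.flow p.1 z) (fun y => cone r y p.2)) =
          fun p => ((N + 1 : ℕ) : ℝ)⁻¹ * ∑ i, cone r (Φ.flow p.1 z i).1 p.2 * (fun _ : V3 => (1 : ℝ)) (Φ.flow p.1 z i).2 := by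
        funext p
        rw [empiricalDensityField_eq_sum]
        simp only [mul_one]
      rw [heq]
      exact measurable_const.mul (measurable_sum_cone_mul hγ r continuous_const)
    refine integrableOn_integral_of_bdd (C := 3 / (Real.pi * r ^ 3) + Cρ)
      (continuous_abs.comp_aestronglyMeasurable
        ((hF.aestronglyMeasurable.sub (aestronglyMeasurable_uncurry_of_continuousOn hgρ)))) fun s hs x => ?_
    rw [Real.norm_eq_abs, abs_abs]
    have h1 : |empiricalDensityField (Φ.flow s z) (fun y => cone r y x)| ≤ 3 / (Real.pi * r ^ 3) := by
      change |DensityCapNegative.mollDensity r (Φ.flow s z) x| ≤ _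
      rw [abs_of_nonneg (mollDensity_nonneg hr _ _)]
      exact mollDensity_le hr _ _
    have h2 : |gρ s x| ≤ Cρ := by rw [← Real.norm_eq_abs]; exact hCρ s hs x
    exact (abs_sub _ _).trans (add_le_add h1 h2)
  · -- momentum
    have hF : Measurable fun p : ℝ × T3 => empiricalMomentumField (Φ.flow p.1 z) (fun y => cone r y p.2) := by
      have heq : (fun p : ℝ × T3 => empiricalMomentumField (Φ.flow p.1 z) (fun y => cone r y p.2)) =
          fun p => ((N + 1 : ℕ) : ℝ)⁻¹ • ∑ i, cone r (Φ.flow p.1 z i).1 p.2 • (fun v : V3 => v) (Φ.flow p.1 z i).2 := by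
        funext p
        rw [empiricalMomentumField_eq_sum]
      rw [heq]
      exact (measurable_const (a := ((N + 1 : ℕ) : ℝ)⁻¹)).smul
        (measurable_sum_kernel_smul hγ (continuous_uncurry_cone r) continuous_id')
    refine integrableOn_integral_of_bdd (C := 3 / (Real.pi * r ^ 3) * (1 / 2 + ((N + 1 : ℕ) : ℝ)⁻¹ * configEnergy z) + Cm)
      ((hF.aestronglyMeasurable.sub (aestronglyMeasurable_uncurry_of_continuousOn hgm)).norm) fun s hs x => ?_
    rw [norm_norm]
    have h1 : ‖empiricalMomentumField (Φ.flow s z) (fun y => cone r y x)‖ ≤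
        3 / (Real.pi * r ^ 3) * (1 / 2 + ((N + 1 : ℕ) : ℝ)⁻¹ * configEnergy z) := by
      rw [empiricalMomentumField_eq_sum, norm_smul, Real.norm_eq_abs, abs_of_nonneg (inv_nonneg.2 hn0.le)]
      calc ((N + 1 : ℕ) : ℝ)⁻¹ * ‖∑ i, cone r (Φ.flow s z i).1 x • (Φ.flow s z i).2‖
          ≤ ((N + 1 : ℕ) : ℝ)⁻¹ * ∑ i, 3 / (Real.pi * r ^ 3) * ‖(Φ.flow s z i).2‖ := by
            refine mul_le_mul_of_nonneg_left ((norm_sum_le _ _).trans (Finset.sum_le_sum fun i _ => ?_))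
              (inv_nonneg.2 hn0.le)
            rw [norm_smul, Real.norm_eq_abs, abs_of_nonneg (cone_nonneg hr _ _)]
            exact mul_le_mul_of_nonneg_right (cone_le hr _ _) (norm_nonneg _)
        _ = 3 / (Real.pi * r ^ 3) * (((N + 1 : ℕ) : ℝ)⁻¹ * ∑ i, ‖(Φ.flow s z i).2‖) := by rw [← Finset.mul_sum]; ring
        _ ≤ 3 / (Real.pi * r ^ 3) * (1 / 2 + ((N + 1 : ℕ) : ℝ)⁻¹ * configEnergy z) := by
            refine mul_le_mul_of_nonneg_left ?_ hpeak
            have h := meanSpeed_le (Φ.flow s z)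
            rwa [hE s] at h
    exact (norm_sub_le _ _).trans (add_le_add h1 (hCm s hs x))
  · -- energy
    have hF : Measurable fun p : ℝ × T3 => empiricalEnergyField (Φ.flow p.1 z) (fun y => cone r y p.2) := by
      have heq : (fun p : ℝ × T3 => empiricalEnergyField (Φ.flow p.1 z) (fun y => cone r y p.2)) =
          fun p => ((N + 1 : ℕ) : ℝ)⁻¹ * ∑ i, cone r (Φ.flow p.1 z i).1 p.2 * (fun v : V3 => ‖v‖ ^ 2 / 2) (Φ.flow p.1 z i).2 := by
        funext p
        rw [empiricalEnergyField_eq_sum]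
      rw [heq]
      exact measurable_const.mul (measurable_sum_cone_mul hγ r ((continuous_norm.pow 2).div_const 2))
    refine integrableOn_integral_of_bdd (C := 3 / (Real.pi * r ^ 3) * (((N + 1 : ℕ) : ℝ)⁻¹ * configEnergy z) + Ce)
      (continuous_abs.comp_aestronglyMeasurable
        ((hF.aestronglyMeasurable.sub (aestronglyMeasurable_uncurry_of_continuousOn hge)))) fun s hs x => ?_
    rw [Real.norm_eq_abs, abs_abs]
    have h1 : |empiricalEnergyField (Φ.flow s z) (fun y => cone r y x)| ≤
        3 / (Real.pi * r ^ 3) * (((N + 1 : ℕ) : ℝ)⁻¹ * configEnergy z) := by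
      rw [empiricalEnergyField_eq_sum, abs_mul, abs_of_nonneg (inv_nonneg.2 hn0.le)]
      calc ((N + 1 : ℕ) : ℝ)⁻¹ * |∑ i, cone r (Φ.flow s z i).1 x * (‖(Φ.flow s z i).2‖ ^ 2 / 2)|
          ≤ ((N + 1 : ℕ) : ℝ)⁻¹ * ∑ i, 3 / (Real.pi * r ^ 3) * (‖(Φ.flow s z i).2‖ ^ 2 / 2) := by
            refine mul_le_mul_of_nonneg_left ((Finset.abs_sum_le_sum_abs _ _).trans
              (Finset.sum_le_sum fun i _ => ?_)) (inv_nonneg.2 hn0.le)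
            rw [abs_mul, abs_of_nonneg (cone_nonneg hr _ _), abs_of_nonneg (by positivity)]
            exact mul_le_mul_of_nonneg_right (cone_le hr _ _) (by positivity)
        _ = 3 / (Real.pi * r ^ 3) * (((N + 1 : ℕ) : ℝ)⁻¹ * ∑ i, ‖(Φ.flow s z i).2‖ ^ 2 / 2) := by
            rw [← Finset.mul_sum]; ring
        _ = 3 / (Real.pi * r ^ 3) * (((N + 1 : ℕ) : ℝ)⁻¹ * configEnergy z) := by rw [meanEnergy_eq, hE s]
    have h2 : |ge s x| ≤ Ce := by rw [← Real.norm_eq_abs]; exact hCe s hs x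
    exact (abs_sub _ _).trans (add_le_add h1 h2)

/-! ## §4 One good instant -/

/-- **One good instant of the window.** In the tied Euler frame (`0 ≤ t`, `t + Δ < T`), along a good orbit, if the
time integral over `[t, t + Δ]` of the sum of the three `L¹(dx)` errors of the `r`-cone-mollified fields against
`(ρ, ρu, E)` is `≤ η₁Δ`, then at some `s₀ ∈ [t, t + Δ]` the sum is `≤ 2η₁` (the errors are integrable in time,
`integrableOn_err`). [folklore] -/
theorem exists_good_instant {N : ℕ} {σ : ℝ} (Φ : HardSphereFlow (Torus.geometry (Fin 3)) (hsDiameter σ N) (N + 1))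
    {z : Config (N + 1) (Fin 3) T3} (hz : z ∈ Φ.good) {r : ℝ} (hr : 0 < r) {T : ℝ} {ρ θ : ℝ → T3 → ℝ}
    {u : ℝ → T3 → V3} (hE : IsHardSphereEulerSolution σ T ρ u θ) {t Δ : ℝ} (ht0 : 0 ≤ t) (hΔ : 0 < Δ)
    (hT : t + Δ < T) {η₁ : ℝ} (hη₁ : 0 < η₁)
    (havg : (∫ s in Set.Icc t (t + Δ),
      ((∫ x, |empiricalDensityField (Φ.flow s z) (fun y => cone r y x) - ρ s x|) +
       (∫ x, ‖empiricalMomentumField (Φ.flow s z) (fun y => cone r y x) - ρ s x • u s x‖) +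
       ∫ x, |empiricalEnergyField (Φ.flow s z) (fun y => cone r y x) - totalEnergyDensity (ρ s x) (u s x) (θ s x)|)) ≤
      η₁ * Δ) :
    ∃ s₀ ∈ Set.Icc t (t + Δ),
      (∫ x, |empiricalDensityField (Φ.flow s₀ z) (fun y => cone r y x) - ρ s₀ x|) +
      (∫ x, ‖empiricalMomentumField (Φ.flow s₀ z) (fun y => cone r y x) - ρ s₀ x • u s₀ x‖) +
      (∫ x, |empiricalEnergyField (Φ.flow s₀ z) (fun y => cone r y x) - totalEnergyDensity (ρ s₀ x) (u s₀ x) (θ s₀ x)|)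
        ≤ 2 * η₁ := by
  obtain ⟨hρc, hmc, hec⟩ := euler_continuousOn hE ht0 hT
  have hint := integrableOn_err Φ hz hr hρc hmc hec
  exact stub_readoutMeasurable (by linarith) hint hη₁ (by rwa [show t + Δ - t = Δ by ring])

end Summit.AtomisticToContinuum.HydrodynamicLimit.Theorems.ChaosClosesEulerReadout

end
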